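import Literature.Geometry.Riemannian.CanonicalNeighbourhoods
import Literature.Geometry.Riemannian.MetricTraceScaling
import HarnessLib

/-!
# Necks, caps and positive curvature operator under constant rescaling `g ↦ c • g`
(topic `Geometry/Riemannian`)

Companion to `RicciFlowScaling.lean`, `MetricTraceScaling.lean`, `RiemannianDistanceScaling.lean`:
the neck and cap notions of `Necks.lean` / `EvolvingNecks.lean` / `CanonicalNeighbourhoods.lean`
are built on the closeness of a RESCALED metric `c · h` to a model (`IsEpsCloseAlong G h c ψ ε`),
so they are scale-covariant by design — Chen–Zhu 2006, §2, p. 4: "`(N, r⁻² g)` is `ε`-close … to a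
standard neck"; §5, p. 26 (a): "after scaling with the factor `R(x, t)`". This file records the
covariance under `g ↦ a • g`, `a > 0`:
* `isEpsCloseAlong_constSmul_iff`: closeness of `a • h` at scale `c` is closeness of `h` at scale
  `c a`;
* `isEpsNeck_constSmul_iff`, `liesInEpsNeck_constSmul_iff`, `isCenterOfEpsNeck_constSmul_iff`:
  an `ε`-neck of radius `r` for `g` is an `ε`-neck of radius `√a r` for `a • g`;
* `IsStrongEpsNeck.parabolicRescale`: a strong `ε`-neck at time `t` and scale `Q` for the flow `g`
  is a strong `ε`-neck at time `a t` and scale `Q/a` for the parabolically rescaled flow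
  `τ ↦ a • g(τ/a)` (the rescaling of `IsMaximalRicciFlow.parabolicRescale`);
* `isEpsCap_constSmul_iff`: `ε`-caps are the same for `g` and `a • g`;
* `curvatureOperatorForm_constSmul`, `bivectorForm_constSmul`,
  `hasPositiveCurvatureOperatorOn_constSmul_iff`: positivity of the curvature operator of
  `(g, ∇)` on a set is invariant (`Rm_{a g} = a Rm_g`, `φ♭_{a g} = a² φ♭_g`).
Recorded for the normalisation "we may assume `T₀ > 1`" of Chen–Zhu 2006, §5, p. 26.

## References

* B.-L. Chen, X.-P. Zhu, arXiv:math/0504478, §2 (p. 4), §4 (p. 24), §5 (p. 26). [ChenZhu2006]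
* R. S. Hamilton, *Four-manifolds with positive isotropic curvature*, Comm. Anal. Geom. 5 (1997),
  §C2, p. 31. [Hamilton1997]
-/

noncomputable section

open Bundle Set Metric Module TopologicalSpace
open scoped Manifold ContDiff Topology

namespace Literature.Geometry.Riemannian

open Lorentzian Lorentzian.PseudoRiemannianMetric

section General

variable {E : Type*} [NormedAddCommGroup E] [NormedSpace ℝ E] {H : Type*} [TopologicalSpace H]
  {I : ModelWithCorners ℝ E H} {M : Type*} [TopologicalSpace M] [ChartedSpace H M]
  [IsManifold I ∞ M] {m : ℕ} {L : ℝ}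

/-- The radius bookkeeping: `((√a r)⁻¹)² · a = (r⁻¹)²` for `a > 0`. [folklore] -/
theorem inv_sqrt_mul_sq_mul {a : ℝ} (ha : 0 < a) (r : ℝ) :
    (Real.sqrt a * r)⁻¹ ^ 2 * a = r⁻¹ ^ 2 := by
  have hsa : Real.sqrt a ≠ 0 := (Real.sqrt_pos.mpr ha).ne'
  rw [mul_inv, mul_pow, inv_pow, Real.sq_sqrt ha.le]
  field_simp

/-- **Closeness under rescaling of the metric**: `a • h` is `ε`-close to `G` at scale `c` along
`ψ` iff `h` is at scale `c a` (`c (a h) = (c a) h`). [folklore] -/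
theorem isEpsCloseAlong_constSmul_iff
    {G : PseudoRiemannianMetric ((𝓡 m).prod 𝓘(ℝ, ℝ)) ∞ (EuclideanSpace ℝ (Fin m) × ℝ)
      (TangentSpace ((𝓡 m).prod 𝓘(ℝ, ℝ)) : (Metric.sphere (0 : EuclideanSpace ℝ (Fin (m + 1))) 1) × ℝ → Type _)}
    {h : PseudoRiemannianMetric I ∞ E (TangentSpace I : M → Type _)} {a : ℝ} (ha : a ≠ 0) {c : ℝ}
    {ψ : neckStrip (EuclideanSpace ℝ (Fin (m + 1))) L → M} {ε : ℝ} :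
    IsEpsCloseAlong G (h.constSmul a ha) c ψ ε ↔ IsEpsCloseAlong G h (c * a) ψ ε := by
  simp only [IsEpsCloseAlong, constSmul_apply, mul_assoc]

/-- **`ε`-necks under rescaling**: `N` is an `ε`-neck of radius `√a · r` in `(M, a g)` iff it is an
`ε`-neck of radius `r` in `(M, g)` (Chen–Zhu 2006, §2, p. 4: the neck condition is on `r⁻² g`,
and `(√a r)⁻² (a g) = r⁻² g`). [cite: ChenZhu2006, §2, p. 4] -/
theorem isEpsNeck_constSmul_iff {g : PseudoRiemannianMetric I ∞ E (TangentSpace I : M → Type _)}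
    {N : Set M} {ε r a : ℝ} (ha : 0 < a) :
    IsEpsNeck m (g.constSmul a ha.ne') N ε (Real.sqrt a * r) ↔ IsEpsNeck m g N ε r := by
  have hsa : 0 < Real.sqrt a := Real.sqrt_pos.mpr ha
  constructor
  · rintro ⟨⟨hε, hr⟩, hopen, ψ, hψ, hrange, hclose⟩
    refine ⟨⟨hε, (mul_pos_iff_of_pos_left hsa).mp hr⟩, hopen, ψ, hψ, hrange, ?_⟩
    rwa [isEpsCloseAlong_constSmul_iff, inv_sqrt_mul_sq_mul ha] at hclose
  · rintro ⟨⟨hε, hr⟩, hopen, ψ, hψ, hrange, hclose⟩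
    refine ⟨⟨hε, mul_pos hsa hr⟩, hopen, ψ, hψ, hrange, ?_⟩
    rwa [isEpsCloseAlong_constSmul_iff, inv_sqrt_mul_sq_mul ha]

/-- The pointed version: `x` lies in an `ε`-neck of radius `√a r` of `a g` iff in one of radius
`r` of `g`. [cite: ChenZhu2006, §2, p. 4] -/
theorem liesInEpsNeck_constSmul_iff {g : PseudoRiemannianMetric I ∞ E (TangentSpace I : M → Type _)}
    {x : M} {ε r a : ℝ} (ha : 0 < a) :
    LiesInEpsNeck m (g.constSmul a ha.ne') x ε (Real.sqrt a * r) ↔ LiesInEpsNeck m g x ε r := by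
  rw [liesInEpsNeck_iff_exists_isEpsNeck, liesInEpsNeck_iff_exists_isEpsNeck]
  simp only [isEpsNeck_constSmul_iff ha]

/-- The centred version: `x` is the centre of an `ε`-neck of radius `√a r` of `a g` iff of one of
radius `r` of `g`. [cite: ChenZhu2006, §2, p. 4] -/
theorem isCenterOfEpsNeck_constSmul_iff
    {g : PseudoRiemannianMetric I ∞ E (TangentSpace I : M → Type _)} {x : M} {ε r a : ℝ}
    (ha : 0 < a) :
    IsCenterOfEpsNeck m (g.constSmul a ha.ne') x ε (Real.sqrt a * r) ↔
      IsCenterOfEpsNeck m g x ε r := by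
  have hsa : 0 < Real.sqrt a := Real.sqrt_pos.mpr ha
  have key : ∀ (ψ : neckStrip (EuclideanSpace ℝ (Fin (m + 1))) ε⁻¹ → M)
      (p : neckStrip (EuclideanSpace ℝ (Fin (m + 1))) ε⁻¹) (v w : TangentSpace ((𝓡 m).prod 𝓘(ℝ, ℝ)) p),
      (Real.sqrt a * r)⁻¹ ^ 2 * (g.constSmul a ha.ne').val (ψ p)
          (mfderiv ((𝓡 m).prod 𝓘(ℝ, ℝ)) I ψ p v) (mfderiv ((𝓡 m).prod 𝓘(ℝ, ℝ)) I ψ p w) =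
        r⁻¹ ^ 2 * g.val (ψ p) (mfderiv ((𝓡 m).prod 𝓘(ℝ, ℝ)) I ψ p v)
          (mfderiv ((𝓡 m).prod 𝓘(ℝ, ℝ)) I ψ p w) := by
    intro ψ p v w
    rw [constSmul_apply, ← mul_assoc, inv_sqrt_mul_sq_mul ha]
  constructor
  · rintro ⟨⟨hε, hr⟩, ψ, hψ, hopen, hx, hclose⟩
    refine ⟨⟨hε, (mul_pos_iff_of_pos_left hsa).mp hr⟩, ψ, hψ, hopen, hx, fun p v w ↦ ?_⟩
    simpa only [key] using hclose p v w
  · rintro ⟨⟨hε, hr⟩, ψ, hψ, hopen, hx, hclose⟩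
    refine ⟨⟨hε, mul_pos hsa hr⟩, ψ, hψ, hopen, hx, fun p v w ↦ ?_⟩
    simpa only [key] using hclose p v w

/-- **Strong `ε`-necks under parabolic rescaling**: if `B` is a strong `ε`-neck at time `t` and
scale `Q` for the flow `g` on the time set `S`, then it is a strong `ε`-neck at time `a t` and
scale `Q/a` for the rescaled flow `τ ↦ a • g(τ/a)` on any time set `S'` containing `a S`
(`a > 0`): the rescaled, time-shifted metrics `(Q/a) · (a g)((a t + s a/Q)/a) = Q g(t + s/Q)`
are literally the same (Chen–Zhu 2006, §5, p. 26 (a), "after scaling with the factor `R(x,t)` and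
shifting the time `t` to zero"). [cite: ChenZhu2006, §5, p. 26, canonical neighborhood assumption (a)] -/
theorem IsStrongEpsNeck.parabolicRescale
    {g : ℝ → PseudoRiemannianMetric I ∞ E (TangentSpace I : M → Type _)} {S S' : Set ℝ}
    {B : Set M} {t Q ε a : ℝ} (ha : 0 < a) (h : IsStrongEpsNeck m g S B t Q ε)
    (hS : ∀ τ ∈ S, a * τ ∈ S') :
    IsStrongEpsNeck m (fun τ ↦ (g (a⁻¹ * τ)).constSmul a ha.ne') S' B (a * t) (a⁻¹ * Q) ε := by
  obtain ⟨⟨hε, hQ⟩, hIcc, hopen, ψ, hψ, hrange, hclose⟩ := h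
  have hQ' : 0 < a⁻¹ * Q := mul_pos (inv_pos.mpr ha) hQ
  refine ⟨⟨hε, hQ'⟩, fun τ hτ ↦ ?_, hopen, ψ, hψ, hrange, fun s hs ↦ ?_⟩
  · -- `τ ∈ [a t - (Q/a)⁻¹, a t]` iff `τ/a ∈ [t - Q⁻¹, t]`
    have hτ' : a⁻¹ * τ ∈ Icc (t - Q⁻¹) t := by
      rw [mul_inv, inv_inv] at hτ
      constructor
      · rw [le_inv_mul_iff₀' ha]   -- a * (t - Q⁻¹) ≤ τ
        nlinarith [hτ.1]
      · rw [inv_mul_le_iff₀' ha]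
        nlinarith [hτ.2]
    have := hS _ (hIcc hτ')
    rwa [mul_inv_cancel_left₀ ha.ne'] at this
  · have harg : a⁻¹ * (a * t + s / (a⁻¹ * Q)) = t + s / Q := by
      field_simp
    show IsEpsCloseAlong _ ((g (a⁻¹ * (a * t + s / (a⁻¹ * Q)))).constSmul a ha.ne') (a⁻¹ * Q) ψ ε
    rw [harg, isEpsCloseAlong_constSmul_iff, mul_comm a⁻¹ Q, inv_mul_cancel_right₀ ha.ne']
    exact hclose s hs

/-- **Curvature operator form under rescaling**: `Rm_{a g}(φ, φ) = a Rm_g(φ, φ)` (same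
connection; `curvatureForm_constSmul`). [folklore] -/
theorem curvatureOperatorForm_constSmul {n : ℕ∞ω}
    (g : PseudoRiemannianMetric I n E (TangentSpace I : M → Type _))
    (cov : CovariantDerivative I E (TangentSpace I : M → Type _)) (a : ℝ) (ha : a ≠ 0) (x : M)
    {k : ℕ} (X Y : Fin k → TangentSpace I x) :
    (g.constSmul a ha).curvatureOperatorForm cov x X Y = a * g.curvatureOperatorForm cov x X Y := by
  simp only [curvatureOperatorForm, curvatureForm_constSmul, Finset.mul_sum]

/-- **The lowered 2-vector under rescaling**: `φ♭_{a g} = a² φ♭_g`. [folklore] -/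
theorem bivectorForm_constSmul {n : ℕ∞ω}
    (g : PseudoRiemannianMetric I n E (TangentSpace I : M → Type _)) (a : ℝ) (ha : a ≠ 0) (x : M)
    {k : ℕ} (X Y : Fin k → TangentSpace I x) (v w : TangentSpace I x) :
    (g.constSmul a ha).bivectorForm x X Y v w = a ^ 2 * g.bivectorForm x X Y v w := by
  simp only [bivectorForm, constSmul_apply, Finset.mul_sum]
  refine Finset.sum_congr rfl fun i _ ↦ ?_
  ring

/-- **Positive curvature operator on a set is scale-invariant** (`a > 0`): `Rm_{a g}(φ,φ) = a Rm_g`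
and `φ ≠ 0` does not depend on the metric used to lower it (`a² ≠ 0`). [folklore] -/
theorem hasPositiveCurvatureOperatorOn_constSmul_iff {n : ℕ∞ω}
    {g : PseudoRiemannianMetric I n E (TangentSpace I : M → Type _)}
    {cov : CovariantDerivative I E (TangentSpace I : M → Type _)} {U : Set M} {a : ℝ} (ha : 0 < a) :
    HasPositiveCurvatureOperatorOn (g.constSmul a ha.ne') cov U ↔
      HasPositiveCurvatureOperatorOn g cov U := by
  have h2 : a ^ 2 ≠ 0 := pow_ne_zero 2 ha.ne'
  constructor
  · intro h x hx k X Y hXY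
    obtain ⟨v, w, hvw⟩ := hXY
    have := h x hx k X Y ⟨v, w, by rwa [bivectorForm_constSmul, mul_ne_zero_iff_left h2]⟩
    rw [curvatureOperatorForm_constSmul] at this
    exact (mul_pos_iff_of_pos_left ha).mp this
  · intro h x hx k X Y hXY
    obtain ⟨v, w, hvw⟩ := hXY
    rw [bivectorForm_constSmul, mul_ne_zero_iff_left h2] at hvw
    rw [curvatureOperatorForm_constSmul]
    exact mul_pos ha (h x hx k X Y ⟨v, w, hvw⟩)

/-- The global version: positive curvature operator of `(a g, ∇)` iff of `(g, ∇)`. [folklore] -/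
theorem hasPositiveCurvatureOperatorWith_constSmul_iff {n : ℕ∞ω}
    {g : PseudoRiemannianMetric I n E (TangentSpace I : M → Type _)}
    {cov : CovariantDerivative I E (TangentSpace I : M → Type _)} {a : ℝ} (ha : 0 < a) :
    (g.constSmul a ha.ne').HasPositiveCurvatureOperatorWith cov ↔
      g.HasPositiveCurvatureOperatorWith cov := by
  rw [← hasPositiveCurvatureOperatorOn_univ_iff, ← hasPositiveCurvatureOperatorOn_univ_iff,
    hasPositiveCurvatureOperatorOn_constSmul_iff ha]

end General

/-! ### `ε`-caps (dimension `4`) -/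

section Cap

variable {M : Type*} [TopologicalSpace M] [ChartedSpace (EuclideanSpace ℝ (Fin 4)) M]
  [IsManifold (𝓡 4) ∞ M]

/-- **`ε`-caps are scale-invariant** (`a > 0`): the topology of `B` is metric-free, the necks of
`a g` covering the end are the necks of `g` with radii multiplied by `√a`
(`isEpsNeck_constSmul_iff`), and `|R(a g)| = a⁻¹ |R(g)|` stays bounded on `B`.
[cite: ChenZhu2006, §4, p. 24] -/
theorem isEpsCap_constSmul_iff
    {g : PseudoRiemannianMetric (𝓡 4) ∞ (EuclideanSpace ℝ (Fin 4)) (TangentSpace (𝓡 4) : M → Type _)}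
    {cov : CovariantDerivative (𝓡 4) (EuclideanSpace ℝ (Fin 4)) (TangentSpace (𝓡 4) : M → Type _)}
    {B : Opens M} {ε a : ℝ} (ha : 0 < a) :
    IsEpsCap (g.constSmul a ha.ne') cov B ε ↔ IsEpsCap g cov B ε := by
  have hsa : Real.sqrt a ≠ 0 := (Real.sqrt_pos.mpr ha).ne'
  have hR : ∀ x, (g.constSmul a ha.ne').scalarCurvatureWith cov x =
      a⁻¹ * g.scalarCurvatureWith cov x :=
    fun x ↦ scalarCurvatureWith_constSmul g a ha.ne' cov x
  constructor
  · rintro ⟨hε, htop, ⟨K, hK, hKB, hneck⟩, ⟨C, hC⟩⟩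
    refine ⟨hε, htop, ⟨K, hK, hKB, fun x hx hxK ↦ ?_⟩, ⟨a * C, fun x hx ↦ ?_⟩⟩
    · obtain ⟨N, r, hNB, hxN, hN⟩ := hneck x hx hxK
      refine ⟨N, r / Real.sqrt a, hNB, hxN, (isEpsNeck_constSmul_iff ha).mp ?_⟩
      rwa [mul_div_cancel₀ _ hsa]
    · have h := hC x hx
      rw [hR, abs_mul, abs_inv, abs_of_pos ha, inv_mul_le_iff₀ ha] at h
      exact h
  · rintro ⟨hε, htop, ⟨K, hK, hKB, hneck⟩, ⟨C, hC⟩⟩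
    refine ⟨hε, htop, ⟨K, hK, hKB, fun x hx hxK ↦ ?_⟩, ⟨a⁻¹ * C, fun x hx ↦ ?_⟩⟩
    · obtain ⟨N, r, hNB, hxN, hN⟩ := hneck x hx hxK
      exact ⟨N, Real.sqrt a * r, hNB, hxN, (isEpsNeck_constSmul_iff ha).mpr hN⟩
    · rw [hR, abs_mul, abs_inv, abs_of_pos ha]
      exact mul_le_mul_of_nonneg_left (hC x hx) (inv_nonneg.mpr ha.le)

end Cap

end Literature.Geometry.Riemannian

end
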